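import Summits.Ventures.HodgeRepro2.T5CMFieldConjugationDecomposition
import Summits.Ventures.HodgeRepro2.T5DecompositionOrder
import Mathlib.GroupTheory.Perm.Cycle.Type

/-!
# FOR EVERY CM FIELD: complex conjugation commutes with every automorphism — it is CENTRAL in `Gal(K/ℚ)`;
# hence a CM field Galois over `ℚ` of degree `2q` (`q` an odd prime), in particular EVERY SEXTIC GALOIS CM FIELD,
# has CYCLIC Galois group

Tier-5 support N2 / N3 / §G-N4.2 (seat p3, gen 80). The brief's «sextic Galois CM case» was worked on the field of
record `ℚ(ζ₇)`, whose Galois group is cyclic by construction (Mathlib's `galEquivZMod`), and files 63–71 carry the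
decomposition-group dictionary under the HYPOTHESIS `[IsCyclic Gal(E/ℚ)]` with an abstract involution `c`. This file
removes both: for EVERY CM field `K` (Mathlib's `IsCMField`) complex conjugation `c = complexConj K` commutes with every
ring endomorphism of `K` (`φ (σ (c x)) = conj ((φ ∘ σ) x) = φ (c (σ x))` for any complex embedding `φ`), so `c` is
central in `Gal(K/ℚ)`; a group of order `2q` with a central involution is cyclic (the quotient by `⟨c⟩` has prime
order, so the group is abelian, and `c · x` has order `2q` for `x` of order `q`); hence `Gal(K/ℚ)` is cyclic for every
CM field Galois over `ℚ` of degree `2q`, `q` an odd prime — every sextic Galois CM field included.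

* `ringHom_complexConj_comm`, `algEquiv_complexConj_comm` — `σ ∘ c = c ∘ σ` for every `σ : K →+* K` / `Gal(K/ℚ)`;
* **`restrictScalars_complexConj_mem_center`** — `c ∈ Z(Gal(K/ℚ))`; `orderOf_restrictScalars_complexConj` (`= 2`);
* `zpowers_normal_of_mem_center`, **`isCyclic_of_card_eq_two_mul_prime`** — the group-theoretic step;
* **`isCyclic_gal_of_finrank_eq_two_mul_prime`**, **`isCyclic_gal_of_finrank_eq_six`** — `Gal(K/ℚ)` is cyclic;
* `eq_restrictScalars_complexConj_of_orderOf_eq_two` — in that case `c` is THE involution of `Gal(K/ℚ)`.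

§8(d): uses an L-value-free non-vanishing device: NO.
-/

open NumberField NumberField.IsCMField

namespace Summit.Ventures.HodgeRepro2.T5CMFieldConjugationCentral

section Central

variable (K : Type*) [Field K] [NumberField K] [IsCMField K]

/-- **Complex conjugation commutes with every ring endomorphism of a CM field**: for a complex embedding `φ`,
`φ (σ (c x)) = (φ ∘ σ) (c x) = conj ((φ ∘ σ) x) = conj (φ (σ x)) = φ (c (σ x))` (Mathlib's
`complexEmbedding_complexConj` applied to the embeddings `φ ∘ σ` and `φ`), and `φ` is injective. -/
theorem ringHom_complexConj_comm (σ : K →+* K) (x : K) :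
    σ (complexConj K x) = complexConj K (σ x) := by
  let φ : K →+* ℂ := Classical.choice (inferInstance : Nonempty _)
  apply φ.injective
  show (φ.comp σ) (complexConj K x) = φ (complexConj K (σ x))
  rw [complexEmbedding_complexConj K (φ.comp σ) x, complexEmbedding_complexConj K φ (σ x)]
  rfl

/-- Complex conjugation commutes with every `ℚ`-automorphism of a CM field. -/
theorem algEquiv_complexConj_comm (σ : K ≃ₐ[ℚ] K) (x : K) :
    σ (complexConj K x) = complexConj K (σ x) :=
  ringHom_complexConj_comm K σ.toAlgHom.toRingHom x

/-- `σ · c = c · σ` in `Gal(K/ℚ)` for every `σ`, with `c = complexConj K` read as a `ℚ`-automorphism. -/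
theorem mul_restrictScalars_complexConj (σ : K ≃ₐ[ℚ] K) :
    σ * (complexConj K).restrictScalars ℚ = (complexConj K).restrictScalars ℚ * σ := by
  ext x
  simp only [AlgEquiv.mul_apply, AlgEquiv.restrictScalars_apply]
  exact algEquiv_complexConj_comm K σ x

/-- **Complex conjugation is CENTRAL in `Gal(K/ℚ)`** for every CM field `K`. -/
theorem restrictScalars_complexConj_mem_center :
    (complexConj K).restrictScalars ℚ ∈ Subgroup.center (K ≃ₐ[ℚ] K) :=
  Subgroup.mem_center_iff.mpr (mul_restrictScalars_complexConj K)

/-- Complex conjugation has order `2` as an element of `Gal(K/ℚ)` (`AlgEquiv.restrictScalarsHom` is injective;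
Mathlib's `orderOf_complexConj`). -/
theorem orderOf_restrictScalars_complexConj :
    orderOf ((complexConj K).restrictScalars ℚ) = 2 := by
  rw [← AlgEquiv.restrictScalarsHom_apply, orderOf_injective _ (AlgEquiv.restrictScalarsHom_injective ℚ),
    orderOf_complexConj]

/-- Complex conjugation is not the identity of `Gal(K/ℚ)`. -/
theorem restrictScalars_complexConj_ne_one :
    (complexConj K).restrictScalars ℚ ≠ 1 := by
  intro h
  have h2 := orderOf_restrictScalars_complexConj K
  rw [h, orderOf_one] at h2
  exact absurd h2 (by norm_num)

end Central

section Group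

variable {G : Type*} [Group G] [Finite G]

omit [Finite G] in
/-- The subgroup generated by a central element is normal. -/
theorem zpowers_normal_of_mem_center {c : G} (hc : c ∈ Subgroup.center G) :
    (Subgroup.zpowers c).Normal := by
  refine ⟨fun n hn g => ?_⟩
  obtain ⟨k, rfl⟩ := Subgroup.mem_zpowers_iff.mp hn
  have hgc : Commute g c := Subgroup.mem_center_iff.mp hc g
  have hcomm : Commute g (c ^ k) := hgc.zpow_right k
  rw [hcomm.eq, mul_inv_cancel_right]
  exact Subgroup.zpow_mem_zpowers c k

/-- **A group of order `2q` (`q` an odd prime) with a CENTRAL element `c` of order `2` is cyclic**: the quotient by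
`⟨c⟩` has prime order `q`, so it is cyclic and `G` is abelian (Mathlib's
`MonoidHom.isMulCommutative_of_isCyclic_of_ker_le_center`); an element `x` of order `q` exists (Cauchy), commutes
with `c`, and `c · x` has order `2q = |G|`. -/
theorem isCyclic_of_card_eq_two_mul_prime {q : ℕ} [hq : Fact q.Prime] (hq2 : q ≠ 2)
    (hcard : Nat.card G = 2 * q) {c : G} (hc2 : orderOf c = 2) (hc : c ∈ Subgroup.center G) :
    IsCyclic G := by
  haveI hZ : (Subgroup.zpowers c).Normal := zpowers_normal_of_mem_center hc
  have hcardZ : Nat.card (Subgroup.zpowers c) = 2 := by rw [Nat.card_zpowers, hc2]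
  have hquot : Nat.card (G ⧸ Subgroup.zpowers c) = q := by
    have h := Subgroup.card_eq_card_quotient_mul_card_subgroup (Subgroup.zpowers c)
    rw [hcard, hcardZ] at h
    omega
  haveI : IsCyclic (G ⧸ Subgroup.zpowers c) := isCyclic_of_prime_card hquot
  have hcomm : IsMulCommutative G :=
    (QuotientGroup.mk' (Subgroup.zpowers c)).isMulCommutative_of_isCyclic_of_ker_le_center
      (by rw [QuotientGroup.ker_mk']; exact Subgroup.zpowers_le.mpr hc)
  obtain ⟨x, hx⟩ := exists_prime_orderOf_dvd_card' q (by rw [hcard]; exact dvd_mul_left q 2)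
  have hcx : Commute c x := hcomm.is_comm.comm c x
  have hco : (orderOf c).Coprime (orderOf x) := by
    rw [hc2, hx]
    exact (Nat.coprime_primes Nat.prime_two hq.out).mpr (Ne.symm hq2)
  exact isCyclic_of_orderOf_eq_card (c * x)
    (by rw [hcx.orderOf_mul_eq_mul_orderOf_of_coprime hco, hc2, hx, hcard])

end Group

section Galois

variable (K : Type*) [Field K] [NumberField K] [IsCMField K] [IsGalois ℚ K]

/-- **A CM field Galois over `ℚ` of degree `2q`, `q` an odd prime, has cyclic Galois group**: complex conjugation
is a central involution of `Gal(K/ℚ)`, a group of order `2q`. -/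
theorem isCyclic_gal_of_finrank_eq_two_mul_prime {q : ℕ} [Fact q.Prime] (hq2 : q ≠ 2)
    (h : Module.finrank ℚ K = 2 * q) : IsCyclic (K ≃ₐ[ℚ] K) :=
  isCyclic_of_card_eq_two_mul_prime hq2 (by rw [IsGalois.card_aut_eq_finrank, h])
    (orderOf_restrictScalars_complexConj K) (restrictScalars_complexConj_mem_center K)

/-- **Every SEXTIC Galois CM field has cyclic Galois group** (`Gal(K/ℚ) ≅ ℤ/6`) — the brief's «sextic Galois CM
case» is always the cyclic case. -/
theorem isCyclic_gal_of_finrank_eq_six (h : Module.finrank ℚ K = 6) : IsCyclic (K ≃ₐ[ℚ] K) :=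
  haveI : Fact (Nat.Prime 3) := ⟨Nat.prime_three⟩
  isCyclic_gal_of_finrank_eq_two_mul_prime K (q := 3) (by norm_num) (h.trans (by norm_num))

/-- When `Gal(K/ℚ)` is cyclic, complex conjugation is ITS involution: every element of order `2` is `c` (file 66's
`eq_of_orderOf_eq_two`). -/
theorem eq_restrictScalars_complexConj_of_orderOf_eq_two [IsCyclic (K ≃ₐ[ℚ] K)] {x : K ≃ₐ[ℚ] K}
    (hx : orderOf x = 2) : x = (complexConj K).restrictScalars ℚ :=
  T5DecompositionOrder.eq_of_orderOf_eq_two (orderOf_restrictScalars_complexConj K) hx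

end Galois

end Summit.Ventures.HodgeRepro2.T5CMFieldConjugationCentral
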